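import Mathlib
import Summits.Ventures.PercRepro2.Defs
import Summits.Ventures.PercRepro2.Graph
import Summits.Ventures.PercRepro2.OneColourSwitch
import Summits.Ventures.PercRepro2.RegionHubSign
import Summits.Ventures.PercRepro2.SideSwitch
import Summits.Ventures.PercRepro2.SideSwitchComps
import Summits.Ventures.PercRepro2.M9NoPocketDefs
import Summits.Ventures.PercRepro2.M9GeneralDSplit
import Summits.Ventures.PercRepro2.M9GeneralDHD
import Summits.Ventures.PercRepro2.M9PocketUnitKonly
import Summits.Ventures.PercRepro2.M9PocketHDTheorem
import Summits.Ventures.PercRepro2.M9PocketProdAssembly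
import Summits.Ventures.PercRepro2.M9PocketRSEdgeTransfer
import Summits.Ventures.PercRepro2.M9PocketRSEdgeSum
import Summits.Ventures.PercRepro2.M9PocketRSEdgeNbrs
import Summits.Ventures.PercRepro2.M9PocketProdAssemblyT

/-!
# [`T`-edge chain] The single-`d` statement with edges inside `{r, s}` and `T`-edges
(blind cell PercRepro2, p3 g40, 2026-08-29; `proofs/P3-POCKETRK.md` §10″–§10‴)

The `r`–`s` gluing of `M9PocketRSEdgeSum` (`hdK_eq_mul_restrict`: the `K`-half of the
hub–dead-end sum of `G` is a non-negative multiple of the one of `G` minus the edges inside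
`{r, s}`) re-applied on top of `M9PocketProdAssemblyT`, the product-fibre chain without the
hypothesis «no `d r`, `d s` edge».  Hence the single-`d` theorem on the non-linking class with
BOTH the edges inside `{r, s}` and the `T`-edges arbitrary:

* **`dSignSum_nonpos_of_sepN_restrict_T`** — `dSignSum ≤ 0` when no `r`–`s` path of `G − d`
  made of edges not inside `{r, s}` has all its vertices among the non-neighbours of `d` and
  `r`, `s` (the honest separation hypothesis when `r`–`s` edges are present);
* `dSignSum_nonpos_of_sepN'_T` — the same with the separation hypothesis read on `G − d` itself
  (void with a direct `r`–`s` edge, still covers loops at `r`, `s`);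
* **`dSignSum_nonpos_of_nbrs_adj_d'_T`** — the neighbours class (every neighbour of `r` or `s`
  other than `r`, `s`, `d` is a neighbour of `d`) with `r`–`s` edges, loops at `r`, `s` and
  `T`-edges arbitrary.

Own work; std axioms.
-/

namespace Summit.Ventures.PercRepro2

namespace NoPocket

open Finset Classical OneColourSwitch SideSwitch

variable {V : Type*} {E : Type*} {ends : E → Sym2 V} {p q r s d : V}

section Main

variable [Fintype V] [DecidableEq V] [Fintype E] [DecidableEq E]

/-- **The single-`d` sign sum is non-positive when the neighbourhood of `d` separates `r` from
`s` in `G` minus the edges inside `{r, s}`, `T`-edges allowed**: no `r`–`s` path of `G − d` made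
of edges not inside `{r, s}` has all its vertices among the non-neighbours of `d` and `r`, `s`
(with `T`-edges `r`, `s` may be neighbours of `d`); the edges `d r`, `d s` and the edges inside
`{r, s}` are arbitrary. -/
theorem dSignSum_nonpos_of_sepN_restrict_T (hdr : d ≠ r) (hds : d ≠ s)
    (hsepN : ¬ Conn (endsD (fun e : {e // e ∉ within ends ({r, s} : Set V)} => ends e.1) d)
      (chi (endsD (fun e : {e // e ∉ within ends ({r, s} : Set V)} => ends e.1) d)
        ({x : V | ∀ e : {e // e ∉ within ends ({r, s} : Set V)}, ends e.1 ≠ s(d, x)} ∪ {r, s}))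
      r s) :
    dSignSum ends p q r s d ≤ 0 := by
  refine dSignSum_nonpos_of_hdSum_nonpos hdr.symm hds.symm ?_
  rw [hdSum_eq_two_mul_hdK, hdK_eq_mul_restrict]
  refine mul_nonpos_iff.2 (Or.inl ⟨by norm_num, ?_⟩)
  refine mul_nonpos_iff.2 (Or.inl ⟨Finset.sum_nonneg fun τ _ => by split_ifs <;> norm_num, ?_⟩)
  by_cases h : p = d ∨ q = d
  · rw [hdK_eq_zero_of_eq h]
  · rw [not_or] at h
    have hrs' : within (fun e : {e // e ∉ within ends ({r, s} : Set V)} => ends e.1)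
        ({r, s} : Set V) = ∅ := by
      ext e
      simp only [Set.mem_empty_iff_false, iff_false]
      rintro ⟨x, hx, y, hy, hxy⟩
      exact e.2 ⟨x, hx, y, hy, hxy⟩
    exact hdK_nonpos_of_noLinking_T hdr hds hrs' h.1 h.2 (noLinking_of_sepN_T hdr hds hsepN)

/-- **The same with the separation hypothesis read on `G − d` itself** (no `r`–`s` path of
`G − d` with all its vertices among the non-neighbours of `d` and `r`, `s`): void when a direct
`r`–`s` edge is present, it still covers loops at `r`, `s`. -/
theorem dSignSum_nonpos_of_sepN'_T (hdr : d ≠ r) (hds : d ≠ s)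
    (hsepN : ¬ Conn (endsD ends d) (chi (endsD ends d)
      ({x : V | ∀ e, ends e ≠ s(d, x)} ∪ {r, s})) r s) :
    dSignSum ends p q r s d ≤ 0 := by
  refine dSignSum_nonpos_of_sepN_restrict_T hdr hds ?_
  intro h'
  apply hsepN
  -- a restricted path through non-neighbours of `d` (or `r`, `s`) is a path of `G − d`
  have hmono : Conn (fun e : {e // e ∉ within ends ({r, s} : Set V)} => endsD ends d e.1)
      (fun e : {e // e ∉ within ends ({r, s} : Set V)} =>
        chi (endsD ends d) ({x : V | ∀ e, ends e ≠ s(d, x)} ∪ {r, s}) e.1) r s := by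
    refine SimpleGraph.Reachable.mono ?_ h'
    intro u v huv
    rw [openGraph_adj] at huv ⊢
    obtain ⟨hne, e, he, hends⟩ := huv
    refine ⟨hne, e, ?_, hends⟩
    rw [chi_eq_true_iff] at he ⊢
    obtain ⟨x, hx, y, hy, hxy⟩ := he
    have key : ∀ z : V, z ∈ {x : V | ∀ e' : {e // e ∉ within ends ({r, s} : Set V)},
        ends e'.1 ≠ s(d, z)} ∪ {r, s} → z ∈ {x : V | ∀ e', ends e' ≠ s(d, x)} ∪ {r, s} := by
      intro z hz
      rcases hz with hz | hz
      · by_cases hzrs : z = r ∨ z = s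
        · exact Or.inr (by rcases hzrs with rfl | rfl <;> simp)
        · refine Or.inl fun e' hz' => ?_
          by_cases hP : e' ∉ within ends ({r, s} : Set V)
          · exact hz ⟨e', hP⟩ hz'
          · rw [not_not] at hP
            exact hzrs (endpoint_of_mem_within hP hz').2
      · exact Or.inr hz
    exact ⟨x, key x hx, y, key y hy, hxy⟩
  exact conn_of_conn_restrict (P := fun e => e ∉ within ends ({r, s} : Set V))
    (ends := endsD ends d)
    (ω := chi (endsD ends d) ({x : V | ∀ e, ends e ≠ s(d, x)} ∪ {r, s})) hmono

/-- **Every neighbour of `r` or `s` (other than `r`, `s`, `d`) adjacent to `d`; the edges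
`d r`, `d s` and the edges inside `{r, s}` arbitrary: `dSignSum ≤ 0`** — the class of
`dSignSum_nonpos_of_nbrs_adj_d'` with `T`-edges. -/
theorem dSignSum_nonpos_of_nbrs_adj_d'_T (hdr : d ≠ r) (hds : d ≠ s)
    (hnb : ∀ e x, (ends e = s(r, x) ∨ ends e = s(s, x)) → x ≠ r → x ≠ s → x ≠ d →
      ∃ e', ends e' = s(d, x)) :
    dSignSum ends p q r s d ≤ 0 := by
  by_cases hrs : r = s
  · rw [dSignSum_eq_zero_of_r_eq_s hrs]
  refine dSignSum_nonpos_of_sepN_restrict_T hdr hds ?_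
  intro hc
  -- no restricted edge through a non-neighbour of `d` leaves `r`
  have hr : s ∈ ({r} : Set V) := by
    refine mem_of_conn_of_closed (S := ({r} : Set V)) ?_ rfl hc
    intro a ha b hab
    rw [Set.mem_singleton_iff] at ha ⊢
    rw [ha] at hab
    obtain ⟨hne, e', he', hends⟩ := openGraph_adj.1 hab
    rw [chi_eq_true_iff] at he'
    obtain ⟨x, hx, y, hy, hxy⟩ := he'
    have hde : d ∉ ends e'.1 := by
      intro hde
      rw [endsD_of_mem (ends := fun e : {e // e ∉ within ends ({r, s} : Set V)} => ends e.1)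
        (e := e') hde, Sym2.eq_iff] at hends
      rcases hends with ⟨h1, _⟩ | ⟨_, h1⟩ <;> exact hdr h1
    rw [endsD_of_notMem (ends := fun e : {e // e ∉ within ends ({r, s} : Set V)} => ends e.1)
      (e := e') hde] at hends hxy
    have hbs : b ≠ s := by
      rintro rfl
      exact e'.2 ⟨r, Or.inl rfl, b, Or.inr rfl, hends⟩
    have hbd : b ≠ d := by
      rintro rfl
      exact hde (by rw [hends]; exact Sym2.mem_mk_right _ _)
    obtain ⟨e'', he''⟩ := hnb e'.1 b (Or.inl hends) (Ne.symm hne) hbs hbd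
    -- `b` is a vertex of the path: a non-neighbour of `d`, or `r`, or `s`
    have hbN : b ∈ {x : V | ∀ e : {e // e ∉ within ends ({r, s} : Set V)}, ends e.1 ≠ s(d, x)} ∪
        {r, s} := by
      rw [hends, Sym2.eq_iff] at hxy
      rcases hxy with ⟨_, h2⟩ | ⟨_, h2⟩
      · rw [h2]; exact hy
      · rw [h2]; exact hx
    have he''F : e'' ∉ within ends ({r, s} : Set V) := by
      intro hF
      rcases (endpoint_of_mem_within hF he'').1 with h | h
      · exact hdr h
      · exact hds h
    rcases hbN with hbN | hbN
    · exact (hbN ⟨e'', he''F⟩ he'').elim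
    · simp only [Set.mem_insert_iff, Set.mem_singleton_iff] at hbN
      rcases hbN with h | h
      · exact (hne h.symm).elim
      · exact (hbs h).elim
  exact hrs (Set.mem_singleton_iff.1 hr).symm

end Main

end NoPocket

end Summit.Ventures.PercRepro2
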